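import Summits.MatrixMultiplication.OmegaCensus.DominoZ5Z5Cover19Defs
import Summits.MatrixMultiplication.OmegaCensus.ThreeSetZ5Z5PlaneCertificate1
import Summits.MatrixMultiplication.OmegaCensus.ThreeSetZ5Z13MomentCertificate1
import Summits.MatrixMultiplication.OmegaCensus.ThreeSetZ5Z65Cells3x
import Summits.MatrixMultiplication.OmegaCensus.ThreeSetZ5Z5Cells44
import HarnessLib

/-!
# Core of the census cell `(1,9,12)@325` (domino, `ℤ₅ × ℤ₆₅`): from the two finite `ℤ₅²`-stage statements to `False`

ω-census `pub-omega`, family (b3), seat pub-omega-group gen 37.  Framing: lottery ticket; floor = certified bounds/negative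
ranges.  VALUE: the MATHEMATICAL part, kernel-checked now, of the route to the last engine-only cell of order `325`
(`HOME/pub-omega-group-g37/DESIGN-1-9-12.md`); the two finite hypotheses `hfin0`, `hfin5` (hole classes `s̄ = 0` and `s̄ = e₁`) are the
pending data campaign (`DominoZ5Z5Data19S*`, staged cover / pin / dispatch files).  NOT progress on ω.

**Theorem (`no_cube_form_19_of_fin`).**  `|A| = 325`, `Φ : A ↠ ℤ₅²`, `Ψ : A →+ ZMod 13` non-zero with vanishing `Φ`-fibre sums; a cube
symmetric form `(W, X, Y, x₀)` with `|W| = 1`, `|X| = 9`; and, for both hole classes `σ ∈ {0, 5}`, the finite statement `Fin19 σ`: every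
count vector `g` of size `9` on `ℤ₅²` has a direction `j ≤ 5` whose domino line datum is certified dead at the hole value `pv 5 j σ`
(`certAt19`), or is an explicit list `e` carrying a plane row refutation at `σ` (`refuteRowOK1`), or a pinning certificate (`pinRowsOK1`) with
all `X`-fibres singletons and an `𝔽₁₃` test vector for each (`momentCertOK1`).  Then `False`.
*Proof.*  Translate `W = {w₀}` to `{0}`; normalise the hole: `Φ(x₀') = 0` (class `0`, `Φ' = Φ`) or `Φ(x₀') ≠ 0` and a linear automorphism
(`basisEquiv`) gives `Φ'(x₀') = e₁ = pt 5 5` (class `5`).  Line branch: the three-set line identity along `lineDir j ∘ Φ'` with `W`-counts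
`[1,0,0,0,0]` and fibre size `65` contradicts `false_of_certAt19`.  Refutation branch: the plane identity at fibre size `13`
(`double_sum_eq_planeMat1`, `false_of_refuteRowOK1`; the bridge holds identically, `bridgeOK1_all`).  Pin branch: `eq_of_pinRowsOK1` pins the
fibre counts of `Y`; the collected fibre-moment identities (`ThreeSetFibreMoment`) have vanishing `W`-block, and `Xs_eq_zero_of_momentCert1`
gives `Ψ(x) = 0` for every `x ∈ X` (singleton fibres); finally the three-set line identity along `Ψ` itself at `t = 0` reads
`27·|Y ∩ ker Ψ| + [Ψ x₀' = 0] = 25` — impossible.  ∎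
-/

namespace Summit.MatrixMultiplication.OmegaCensus

open Finset ZpZpDomino Z5Z5ThreeSet FibreMoment

namespace Z5Z5ThreeSet

/-- A non-zero point of `ℤ₅²` extends to a basis. [folklore] -/
theorem exists_basis_partner : ∀ s : ZMod 5 × ZMod 5, s ≠ 0 → ∃ v : ZMod 5 × ZMod 5, s.1 * v.2 - s.2 * v.1 ≠ 0 := by decide

/-- `pt 5 0 = 0` and `pt 5 5 = e₁`. [folklore] -/
theorem pt_zero_five : pt 5 0 = (0 : ZMod 5 × ZMod 5) ∧ pt 5 5 = ((1, 0) : ZMod 5 × ZMod 5) := by decide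

/-- The `W`-image of `{0}` on a line: `𝟙[t = 0] = vecFn w0vec t`. [folklore] -/
theorem ite_zero_eq_vecFn_w0vec (t : ZMod 5) : (if (0 : ZMod 5) = t then 1 else 0) = vecFn w0vec t := by revert t; decide

/-- The `W`-image of `{0}` on the plane: `𝟙[v = 0] = gridFn t0list v`. [folklore] -/
theorem ite_zero_eq_gridFn_t0list (v : ZMod 5 × ZMod 5) : (if (0 : ZMod 5 × ZMod 5) = v then 1 else 0) = gridFn t0list v := by
  revert v; decide

end Z5Z5ThreeSet

section Core

variable {A : Type*} [AddCommGroup A] [Fintype A] [DecidableEq A]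

omit [Fintype A] [DecidableEq A] in
/-- Fibre counts of the singleton `{0}` along any additive map. [folklore] -/
theorem card_filter_singleton_zero {B : Type*} [AddCommGroup B] [DecidableEq B] (φ : A →+ B) (t : B) :
    ((({0} : Finset A)).filter fun a => φ a = t).card = if (0 : B) = t then 1 else 0 := by
  rw [filter_singleton, map_zero]
  by_cases h : (0 : B) = t
  · rw [if_pos h, if_pos h, card_singleton]
  · rw [if_neg h, if_neg h, card_empty]

/-- All fibres of a surjection onto `ZMod 13` have size `|A| / 13`. [folklore] -/
theorem thirteen_mul_card_fibre (ψ : A →+ ZMod 13) (hψ : Function.Surjective ψ) :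
    13 * (univ.filter fun a : A => ψ a = 0).card = Fintype.card A := by
  classical
  rw [← Finset.card_univ (α := A), Finset.card_eq_sum_card_fiberwise (f := fun a : A => ψ a) (s := univ) (t := univ)
    (fun a _ => mem_coe.2 (mem_univ _))]
  rw [Finset.sum_congr rfl fun t _ => card_fibre_eq_of_surjective ψ hψ t 0, sum_const, card_univ, ZMod.card, smul_eq_mul]

omit [DecidableEq A] in
/-- A non-zero additive map into `ZMod 13` is onto. [folklore] -/
theorem surjective_of_ne_zero_zmod13 (Ψ : A →+ ZMod 13) (hΨ : Ψ ≠ 0) : Function.Surjective Ψ := by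
  have ⟨a, ha⟩ : ∃ a, Ψ a ≠ 0 := by
    by_contra h
    push Not at h
    exact hΨ (AddMonoidHom.ext fun x => by simpa using h x)
  intro k
  haveI : Fact (Nat.Prime 13) := ⟨by norm_num⟩
  refine ⟨(k * (Ψ a)⁻¹).val • a, ?_⟩
  rw [map_nsmul, nsmul_eq_mul, ZMod.natCast_zmod_val, mul_assoc, inv_mul_cancel₀ ha, mul_one]

/-- **Core of `(1,9,12)@325` for a fixed hole class**: translated form (`W' = {0}`), a surjection `Φ'` with `Φ' x₀' = pt 5 σ`, vanishing
`Φ'`-fibre sums of `Ψ`, and the finite statement `Fin19 σ`.  Then `False`. [folklore] -/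
theorem no_cube_form_19_class (σ : ℕ) (hσ : σ < 25)
    (hfin : (∀ g : Fin (5 * 5) → ℕ, ∑ i, g i = 9 →
        (∃ j < 6, certAt19 σ j (cnts 5 j g) = true) ∨
        ∃ e : List ℕ, (∀ i : Fin (5 * 5), g i = e.getD i.val 0) ∧
          ((∃ c : ℕ × ℕ × List ℤ, c.1 < 25 ∧ refuteRowOK1 e σ c = true) ∨
           (∃ h : List ℕ, ∃ rows : List (ℕ × List ℤ), pinRowsOK1 e σ h rows = true ∧
              ∀ r : ZMod 5 × ZMod 5, gridFn e r ≠ 0 → gridFn e r = 1 ∧ ∃ L : List ℕ, momentCertOK1 e h L r (pt 5 σ) = true))))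
    (hA : Fintype.card A = 325)
    (Φ' : A →+ ZMod 5 × ZMod 5) (hΦ's : Function.Surjective Φ') (Ψ : A →+ ZMod 13) (hΨ : Ψ ≠ 0)
    (hΨΦ' : ∀ t : ZMod 5 × ZMod 5, ∑ a ∈ univ.filter (fun a : A => Φ' a = t), Ψ a = 0)
    {X' Y' : Finset A} {x₀' : A} (hX : X'.card = 9) (hx₀ : Φ' x₀' = pt 5 σ)
    (t₁ : Set.InjOn (fun p : A × A × A => -p.1 + p.2.1 + p.2.2) ↑(({0} : Finset A) ×ˢ X' ×ˢ Y'))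
    (t₂ : Set.InjOn (fun p : A × A × A => p.1 - p.2.1 + p.2.2) ↑(({0} : Finset A) ×ˢ X' ×ˢ Y'))
    (t₃ : Set.InjOn (fun p : A × A × A => p.1 + p.2.1 - p.2.2) ↑(({0} : Finset A) ×ˢ X' ×ˢ Y'))
    (e₁₂ : Disjoint ((({0} : Finset A) ×ˢ X' ×ˢ Y').image fun p : A × A × A => -p.1 + p.2.1 + p.2.2)
      ((({0} : Finset A) ×ˢ X' ×ˢ Y').image fun p : A × A × A => p.1 - p.2.1 + p.2.2))
    (e₁₃ : Disjoint ((({0} : Finset A) ×ˢ X' ×ˢ Y').image fun p : A × A × A => -p.1 + p.2.1 + p.2.2)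
      ((({0} : Finset A) ×ˢ X' ×ˢ Y').image fun p : A × A × A => p.1 + p.2.1 - p.2.2))
    (e₂₃ : Disjoint ((({0} : Finset A) ×ˢ X' ×ˢ Y').image fun p : A × A × A => p.1 - p.2.1 + p.2.2)
      ((({0} : Finset A) ×ˢ X' ×ˢ Y').image fun p : A × A × A => p.1 + p.2.1 - p.2.2))
    (tcov : ((({0} : Finset A) ×ˢ X' ×ˢ Y').image fun p : A × A × A => -p.1 + p.2.1 + p.2.2) ∪
      ((({0} : Finset A) ×ˢ X' ×ˢ Y').image fun p : A × A × A => p.1 - p.2.1 + p.2.2) ∪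
      ((({0} : Finset A) ×ˢ X' ×ˢ Y').image fun p : A × A × A => p.1 + p.2.1 - p.2.2) = univ.erase x₀') : False := by
  classical
  set g : Fin (5 * 5) → ℕ := fun i => (X'.filter fun a => Φ' a = pt 5 i.val).card with hg
  have hgsum : ∑ i, g i = 9 := by
    have h0 := ZpZpDomino.sum_card_fibre_shift Φ' X' 0
    rw [sum_eq_sum_pt 5] at h0
    simp only [add_zero] at h0
    rw [hX] at h0
    exact h0
  rcases hfin g hgsum with ⟨j, hj, hcert⟩ | ⟨e, hge, hrest⟩
  · -- (a) a certified LINE direction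
    set π : ZMod 5 × ZMod 5 →+ ZMod 5 := lineDir 5 j with hπ
    set φ : A →+ ZMod 5 := π.comp Φ' with hφ
    have hφs : Function.Surjective φ := (lineDir_surjective 5 j).comp hΦ's
    have eφ : ∀ a, φ a = π (Φ' a) := fun a => rfl
    have hWl : ∀ t : ZMod 5, ((({0} : Finset A)).filter fun a => φ a = t).card = vecFn w0vec t := by
      intro t; rw [card_filter_singleton_zero, ite_zero_eq_vecFn_w0vec]
    have hXl : ∀ t : ZMod 5, (X'.filter fun a => φ a = t).card = vecFn (cnts 5 j g) t := by
      intro t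
      show _ = (cnts 5 j g).getD t.val 0
      rw [getD_cnts j g (ZMod.val_lt t), ← sum_filter_eq_sum_pick 5 j (fun w => (X'.filter fun a => Φ' a = w).card)
        (ZMod.val_lt t), ZMod.natCast_zmod_val, ← card_fibre_comp_eq_sum Φ' π X' t]
      simp only [eφ]
    have hhole : φ x₀' = ((pv 5 j σ : ℕ) : ZMod 5) := by
      rw [eφ, hx₀, ← lineDir_pt_val 5 j σ, ZMod.natCast_zmod_val]
    have hK : (univ.filter fun a : A => φ a = 0).card = 65 := by
      have h5 := five_mul_card_fibre φ hφs
      rw [hA] at h5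
      omega
    refine false_of_certAt19 hcert (fun t => (Y'.filter fun a => φ a = t).card) (lineMat3_identity_of_double_sum fun t => ?_)
    have hid := ThreeSetNorm.three_set_line_identity φ hφs t₁ t₂ t₃ e₁₂ e₁₃ e₂₃ tcov t
    simp only [hWl, hXl, hhole, hK] at hid
    exact hid
  · -- (b) an explicit exception: the PLANE identity at fibre size `13`
    have hK : (univ.filter fun a : A => Φ' a = 0).card = 13 := by
      have h25 := twentyfive_mul_card_fibre Φ' hΦ's
      rw [hA] at h25
      omega
    have hXg : ∀ w : ZMod 5 × ZMod 5, (X'.filter fun a => Φ' a = w).card = gridFn e w := by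
      intro w
      have h1 := hge ⟨ptIdx 5 w, ptIdx_lt 5 w⟩
      simp only [hg, pt_ptIdx] at h1
      exact h1
    have hplane : ∀ t : ZMod 5 × ZMod 5, (∑ w : ZMod 5 × ZMod 5, planeMat1 e t w * (Y'.filter fun a => Φ' a = w).card) +
        (if pt 5 σ = t then 1 else 0) = 13 := by
      intro t
      have hid := ThreeSetNorm.three_set_line_identity Φ' hΦ's t₁ t₂ t₃ e₁₂ e₁₃ e₂₃ tcov t
      have hds := double_sum_eq_planeMat1 (fun w => ((({0} : Finset A)).filter fun a => Φ' a = w).card)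
        (fun w => (X'.filter fun a => Φ' a = w).card) (fun w => (Y'.filter fun a => Φ' a = w).card) e
        (by rw [card_filter_singleton_zero, if_pos rfl]) (fun v hv => by rw [card_filter_singleton_zero, if_neg (Ne.symm hv)]) hXg t
      rw [hK, hds, hx₀] at hid
      exact hid
    rcases hrest with ⟨c, hcu, hc⟩ | ⟨h, rows, hpin, hsupp⟩
    · exact false_of_refuteRowOK1 (bridgeOK1_all e) hσ hc hcu _ hplane
    · -- (b2) pinned: `Y` counts, the `ℤ₁₃` moment stage, and the count of zeros of `Ψ`
      have hYg : ∀ w : ZMod 5 × ZMod 5, (Y'.filter fun a => Φ' a = w).card = gridFn h w :=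
        eq_of_pinRowsOK1 (bridgeOK1_all e) hσ hpin _ hplane
      have eW : fcnt Φ' ({0} : Finset A) = zc t0list := by
        funext w; unfold fcnt zc; rw [card_filter_singleton_zero, ite_zero_eq_gridFn_t0list]
      have eX : fcnt Φ' X' = zc e := by funext w; unfold fcnt zc; rw [hXg w]
      have eY : fcnt Φ' Y' = zc h := by funext w; unfold fcnt zc; rw [hYg w]
      have hmom : ∀ t : ZMod 5 × ZMod 5,
          (∑ w, fsum Φ' Ψ ({0} : Finset A) w * momA (zc e) (zc h) t w) + (∑ r, fsum Φ' Ψ X' r * momB (zc t0list) (zc h) t r) +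
            (∑ w, fsum Φ' Ψ Y' w * momC (zc t0list) (zc e) t w) + (if pt 5 σ = t then Ψ x₀' else 0) = 0 := by
        intro t
        have hid := fibre_moment_identity Φ' Ψ t₁ t₂ t₃ e₁₂ e₁₃ e₂₃ tcov t
        rw [fibre_moment_collected, hΨΦ' t, eW, eX, eY, hx₀] at hid
        exact hid
      have hW0 : ∀ w : ZMod 5 × ZMod 5, fsum Φ' Ψ ({0} : Finset A) w = 0 := by
        intro w
        unfold fsum
        rw [filter_singleton, map_zero]
        split_ifs <;> simp
      have hX0 : ∀ r : ZMod 5 × ZMod 5, gridFn e r = 0 → fsum Φ' Ψ X' r = 0 := by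
        intro r hr
        unfold fsum
        rw [← hXg r, card_eq_zero] at hr
        rw [hr, sum_empty]
      have hY0 : ∀ w : ZMod 5 × ZMod 5, gridFn h w = 0 → fsum Φ' Ψ Y' w = 0 := by
        intro w hw
        unfold fsum
        rw [← hYg w, card_eq_zero] at hw
        rw [hw, sum_empty]
      -- `Ψ` vanishes on `X'`
      have hΨX : ∀ x ∈ X', Ψ x = 0 := by
        intro x hx
        have hne : gridFn e (Φ' x) ≠ 0 := by
          rw [← hXg (Φ' x)]
          exact card_ne_zero.2 ⟨x, mem_filter.2 ⟨hx, rfl⟩⟩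
        obtain ⟨h1, L, hL⟩ := hsupp (Φ' x) hne
        have hXs := Xs_eq_zero_of_momentCert1 hL hne _ _ _ _ hmom hW0 hX0 hY0
        -- the fibre of `X'` over `Φ' x` is `{x}`
        have hfib : (X'.filter fun a => Φ' a = Φ' x) = {x} := by
          have hc : (X'.filter fun a => Φ' a = Φ' x).card = 1 := by rw [hXg, h1]
          obtain ⟨y, hy⟩ := card_eq_one.1 hc
          have hxmem : x ∈ (X'.filter fun a => Φ' a = Φ' x) := mem_filter.2 ⟨hx, rfl⟩
          rw [hy, mem_singleton] at hxmem
          rw [hy, hxmem]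
        unfold fsum at hXs
        rw [hfib, sum_singleton] at hXs
        exact hXs
      -- the count of zeros of `Ψ` on `A ∖ {x₀'}`: the three-set line identity along `Ψ` at `t = 0`
      have hΨs : Function.Surjective Ψ := surjective_of_ne_zero_zmod13 Ψ hΨ
      have hK13 : (univ.filter fun a : A => Ψ a = 0).card = 25 := by
        have h13 := thirteen_mul_card_fibre Ψ hΨs
        rw [hA] at h13
        omega
      have hWΨ : ∀ v : ZMod 13, ((({0} : Finset A)).filter fun a => Ψ a = v).card = if (0 : ZMod 13) = v then 1 else 0 :=
        fun v => card_filter_singleton_zero Ψ v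
      have hXΨ : ∀ v : ZMod 13, (X'.filter fun a => Ψ a = v).card = if v = 0 then 9 else 0 := by
        intro v
        by_cases hv : v = 0
        · have hf : (X'.filter fun a => Ψ a = v) = X' := filter_true_of_mem fun x hx => by rw [hΨX x hx, hv]
          rw [hf, if_pos hv, hX]
        · have hf : (X'.filter fun a => Ψ a = v) = ∅ :=
            filter_false_of_mem fun x hx h => hv (by rw [← h, hΨX x hx])
          rw [hf, if_neg hv, card_empty]
      have hid := ThreeSetNorm.three_set_line_identity Ψ hΨs t₁ t₂ t₃ e₁₂ e₁₃ e₂₃ tcov (0 : ZMod 13)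
      rw [hK13] at hid
      have step : ∀ u v : ZMod 13, ((({0} : Finset A)).filter fun a => Ψ a = v).card *
          ((X'.filter fun a => Ψ a = 0 - u + v).card + (X'.filter fun a => Ψ a = v + u - 0).card +
            (X'.filter fun a => Ψ a = 0 + u - v).card) * (Y'.filter fun a => Ψ a = u).card =
          if v = 0 then (if u = 0 then 27 * (Y'.filter fun a => Ψ a = 0).card else 0) else 0 := by
        intro u v
        by_cases hv : v = 0
        · rw [if_pos hv, hWΨ, if_pos hv.symm, one_mul, hv]
          have e1 : (0 : ZMod 13) - u + 0 = -u := by abel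
          have e2 : (0 : ZMod 13) + u - 0 = u := by abel
          rw [e1, e2, hXΨ, hXΨ]
          by_cases hu : u = 0
          · rw [if_pos hu, if_pos (neg_eq_zero.2 hu), if_pos hu, hu]
          · rw [if_neg hu, if_neg (fun h' => hu (neg_eq_zero.1 h')), if_neg hu, add_zero, add_zero, zero_mul]
        · rw [if_neg hv, hWΨ, if_neg (fun h' => hv h'.symm), zero_mul, zero_mul]
      rw [Finset.sum_congr rfl fun u _ => Finset.sum_congr rfl fun v _ => step u v] at hid
      simp only [Finset.sum_ite_eq', Finset.mem_univ, if_true] at hid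
      by_cases h0 : Ψ x₀' = 0
      · rw [if_pos h0] at hid; omega
      · rw [if_neg h0] at hid; omega

/-- **The domino cell `(1,9,12)@325` from the two finite statements.**  `|A| = 325`, `Φ : A ↠ ℤ₅²`, `Ψ : A →+ ZMod 13` non-zero with
vanishing `Φ`-fibre sums, `Fin19 0` and `Fin19 5`; a cube symmetric form with `|W| = 1`, `|X| = 9`.  Then `False`. [folklore] -/
theorem no_cube_form_19_of_fin
    (hfin0 : (∀ g : Fin (5 * 5) → ℕ, ∑ i, g i = 9 →
        (∃ j < 6, certAt19 0 j (cnts 5 j g) = true) ∨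
        ∃ e : List ℕ, (∀ i : Fin (5 * 5), g i = e.getD i.val 0) ∧
          ((∃ c : ℕ × ℕ × List ℤ, c.1 < 25 ∧ refuteRowOK1 e 0 c = true) ∨
           (∃ h : List ℕ, ∃ rows : List (ℕ × List ℤ), pinRowsOK1 e 0 h rows = true ∧
              ∀ r : ZMod 5 × ZMod 5, gridFn e r ≠ 0 → gridFn e r = 1 ∧ ∃ L : List ℕ, momentCertOK1 e h L r (pt 5 0) = true))))
    (hfin5 : (∀ g : Fin (5 * 5) → ℕ, ∑ i, g i = 9 →
        (∃ j < 6, certAt19 5 j (cnts 5 j g) = true) ∨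
        ∃ e : List ℕ, (∀ i : Fin (5 * 5), g i = e.getD i.val 0) ∧
          ((∃ c : ℕ × ℕ × List ℤ, c.1 < 25 ∧ refuteRowOK1 e 5 c = true) ∨
           (∃ h : List ℕ, ∃ rows : List (ℕ × List ℤ), pinRowsOK1 e 5 h rows = true ∧
              ∀ r : ZMod 5 × ZMod 5, gridFn e r ≠ 0 → gridFn e r = 1 ∧ ∃ L : List ℕ, momentCertOK1 e h L r (pt 5 5) = true))))
    (hA : Fintype.card A = 325)
    (Φ : A →+ ZMod 5 × ZMod 5) (hΦ : Function.Surjective Φ)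
    (Ψ : A →+ ZMod 13) (hΨ : Ψ ≠ 0) (hΨΦ : ∀ t : ZMod 5 × ZMod 5, ∑ a ∈ univ.filter (fun a : A => Φ a = t), Ψ a = 0)
    {W X Y : Finset A} {x₀ : A} (hW : W.card = 1) (hX : X.card = 9)
    (h₁ : Set.InjOn (fun p : A × A × A => -p.1 + p.2.1 + p.2.2) ↑(W ×ˢ X ×ˢ Y))
    (h₂ : Set.InjOn (fun p : A × A × A => p.1 - p.2.1 + p.2.2) ↑(W ×ˢ X ×ˢ Y))
    (h₃ : Set.InjOn (fun p : A × A × A => p.1 + p.2.1 - p.2.2) ↑(W ×ˢ X ×ˢ Y))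
    (d₁₂ : Disjoint ((W ×ˢ X ×ˢ Y).image fun p : A × A × A => -p.1 + p.2.1 + p.2.2)
      ((W ×ˢ X ×ˢ Y).image fun p : A × A × A => p.1 - p.2.1 + p.2.2))
    (d₁₃ : Disjoint ((W ×ˢ X ×ˢ Y).image fun p : A × A × A => -p.1 + p.2.1 + p.2.2)
      ((W ×ˢ X ×ˢ Y).image fun p : A × A × A => p.1 + p.2.1 - p.2.2))
    (d₂₃ : Disjoint ((W ×ˢ X ×ˢ Y).image fun p : A × A × A => p.1 - p.2.1 + p.2.2)
      ((W ×ˢ X ×ˢ Y).image fun p : A × A × A => p.1 + p.2.1 - p.2.2))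
    (hcover : ((W ×ˢ X ×ˢ Y).image fun p : A × A × A => -p.1 + p.2.1 + p.2.2) ∪
      ((W ×ˢ X ×ˢ Y).image fun p : A × A × A => p.1 - p.2.1 + p.2.2) ∪
      ((W ×ˢ X ×ˢ Y).image fun p : A × A × A => p.1 + p.2.1 - p.2.2) = univ.erase x₀) : False := by
  classical
  obtain ⟨w₀, hWeq⟩ := card_eq_one.1 hW
  obtain ⟨t₁, t₂, t₃, e₁₂, e₁₃, e₂₃, tcov, -, cX, -⟩ :=
    cube_symmetric_form_translate h₁ h₂ h₃ d₁₂ d₁₃ d₂₃ hcover (-w₀)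
  have hWt : W.image (· + -w₀) = ({0} : Finset A) := by rw [hWeq, image_singleton, add_neg_cancel]
  rw [hWt] at t₁ t₂ t₃ e₁₂ e₁₃ e₂₃ tcov
  set X' := X.image (· + -w₀) with hX'
  set Y' := Y.image (· + -w₀) with hY'
  rw [hX] at cX
  -- fibre sums along a basis-changed projection
  have hΨΦE : ∀ (E : ZMod 5 × ZMod 5 ≃+ ZMod 5 × ZMod 5) (t : ZMod 5 × ZMod 5),
      ∑ a ∈ univ.filter (fun a : A => (E.symm.toAddMonoidHom.comp Φ) a = t), Ψ a = 0 := by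
    intro E t
    have hset : (univ.filter fun a : A => (E.symm.toAddMonoidHom.comp Φ) a = t) = univ.filter fun a : A => Φ a = E t := by
      ext a
      simp only [mem_filter, mem_univ, true_and, AddMonoidHom.coe_comp, Function.comp_apply, AddEquiv.coe_toAddMonoidHom]
      rw [AddEquiv.symm_apply_eq]
    rw [hset]; exact hΨΦ (E t)
  by_cases hs : Φ (x₀ + -w₀) = 0
  · -- class `0`: no basis change
    exact no_cube_form_19_class 0 (by norm_num) hfin0 hA Φ hΦ Ψ hΨ hΨΦ cX (by rw [hs, pt_zero_five.1]) t₁ t₂ t₃ e₁₂ e₁₃ e₂₃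
      tcov
  · -- class `e₁`: a basis change puts the hole at `e₁`
    obtain ⟨v, hD⟩ := exists_basis_partner (Φ (x₀ + -w₀)) hs
    haveI : Fact (Nat.Prime 5) := ⟨by norm_num⟩
    set E := basisEquiv (Φ (x₀ + -w₀)) v hD with hE
    set Φ' : A →+ ZMod 5 × ZMod 5 := E.symm.toAddMonoidHom.comp Φ with hΦ'
    have hΦ's : Function.Surjective Φ' := E.symm.surjective.comp hΦ
    have hx : Φ' (x₀ + -w₀) = pt 5 5 := by
      rw [pt_zero_five.2]
      show E.symm (Φ (x₀ + -w₀)) = _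
      rw [AddEquiv.symm_apply_eq]; exact (basisEquiv_one_zero _ _ hD).symm
    exact no_cube_form_19_class 5 (by norm_num) hfin5 hA Φ' hΦ's Ψ hΨ (hΨΦE E) cX hx t₁ t₂ t₃ e₁₂ e₁₃ e₂₃ tcov

end Core

end Summit.MatrixMultiplication.OmegaCensus
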